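import Mathlib
import HarnessLib
import Summits.NavierStokesRegularity.NavierStokesRegularity.Theses.LocalHelicityTubeDoor

/-!
# Route `LocalHelicityTubeDoor` (S11, rung N0-LocalTubeDoorHelicity) — the ASSEMBLY

Cell ns-regularity-ideate, seat p6 (birth filing; the route was opened from nsreg-p1 g11's staged package
HOME/ns-regularity-ideate-p1/route-helicity/).  The assembly `LocalPointZoomVelCurlSlices → FrobeniusProfileRigidity → Target`
is the gate-certified deciding theorem `closes` (tree glue `localTubeDoorHelicity_of` after the window → slice reduction
`frobeniusWindowRigidity_of_profileRigidity`); this file records it BY NAME against the born Theses decl (closing item stmt-NavierStokesRegularity-19977).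
K1‴ is a tree theorem; K2⁗ is OPEN, so the leaf itself stays conditional (see `…Theorems.LocalHelicityTubeDoorTargetOfProfileRigidity`).

WHAT THIS IS NOT: not a claim about Navier–Stokes regularity (Clay A) and not the open crux K2⁗.  The leaf is a regularity
CRITERION (local Type I + L¹-fading of the scale-normalised helicity density (T−t)^{3/2}·⟪u, curl u⟫ on ONE similarity
window ⇒ backward bounded) CONDITIONAL on K2⁗ `FrobeniusProfileRigidity` (rigidity of helicity-free Type-I profiles,
OPEN); one rung of LADDER-NS N0 (N0-LocalTubeDoorHelicity); establishment in the cell's sense still requires the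
cross-family referee PASS + independent reproduction.
-/

noncomputable section

-- the summit and its single sub-problem share the name (CONVENTIONS §1), as in every Theorems file
set_option linter.dupNamespace false

namespace Summit.NavierStokesRegularity.NavierStokesRegularity.Theorems.LocalHelicityTubeDoorAssembly

open Summit.NavierStokesRegularity.NavierStokesRegularity.Theses.LocalHelicityTubeDoor

/-- **The route's `Assembly` (item stmt-NavierStokesRegularity-19977)**: `LocalPointZoomVelCurlSlices → FrobeniusProfileRigidity → Target`,
by the gate-certified deciding theorem `closes`. -/
theorem assembly_proof :
    Summit.NavierStokesRegularity.NavierStokesRegularity.Theses.LocalHelicityTubeDoor.Assembly :=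
  fun h₁ h₂ => closes h₁ h₂

end Summit.NavierStokesRegularity.NavierStokesRegularity.Theorems.LocalHelicityTubeDoorAssembly

end
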